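import Summits.HodgeConjecture.HodgeConjecture.Theorems.K2E3BranchBHaarFactsN         -- ★ p861971 (R90-C10-p04): the frame + `setOf_conj_mem_eq_rankStratum_zero`, `setOf_coe_mem_eq_setOf_mem_integralLevel` (place-generic)
import Literature.NumberTheory.Automorphic.HeisenbergStrataMeasureRamified             -- ★ `measureReal_rankStratum_zero_of_ramified` (`μ_N(S₀) = q⁻¹ · μ_N(N ∩ K₃)` at a ramified odd place)
import HarnessLib

/-!
# R90 · S1 ∕ U4Keys leaf (U4f-χ₁-ram-one-d0B) — step Z3 (III) at a RAMIFIED place: `μ{n : w₀ n w₀ ∈ I} = q⁻¹ · μ{n : n ∈ I}` on `N(L⁺_v)` for EVERY Haar `μ`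
# (`vol N(𝔭) = q⁻¹ · vol N₀` — NOT `q⁻³` as at inert places) [PAPER-Z3-DepthZeroRamified §0–§1 (R90-C10-p05 (g0), r01-screened); Rogawski1990 §4.9, §12.2; Casselman1980 §3]

Cell `hodgecm-mathlib`, SLAB R90-TF, section S1 «Ch. 12 local», crux H413 = `stmt-HodgeConjecture-24833` (lane `--supports … --as helper`), route HCCMUnconditional; prover seat
`hodgecm-mathlib-R90-C10-p05` (g0); socket of record S1#3′ = K2E3 leaf (U4f-χ₁-ram-one) ⊇ U4Keys :155 (depth 0, Branch B).  THEOREMS ONLY (no definition ∕ instance ∕ notation ∕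
named fact ∕ `sorry`); ★-only imports.  The RAMIFIED twin of ★ `K2E3BranchBHaarFactsN.measureReal_setOf_conj_mem_eq` (R90-C10-p04, inert: constant `q⁻³`, hypothesis `hunr`), in the
SAME (G3) frame `L v w hw eA heA ϖ hϖ g₁ hg₁ K0 K1 I hK0 hK1 hI t ht w₀ hw₀` — it is the constant entry `Λ_{w₀} f₁ = q⁻¹ · Λ_1 f_w = q⁻¹ · V` of the ramified Casselman pair (the
`h1wv` letter of ★∕📤 `R90S1BranchBEndAssemblyRamified.exists_eta_of_det_eq_zero_of_pairEntries_ram`).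

THE POINT.  ★ `setOf_conj_mem_eq_rankStratum_zero` and ★ `setOf_coe_mem_eq_setOf_mem_integralLevel` (both place-generic) identify `{w₀ n w₀ ∈ I}` with the rank-0 stratum
`S₀ = {n ∈ N ∩ K_v : rank(red(n_w) − 1) = 0}` and `{n ∈ I}` with `N ∩ K_v`; at a RAMIFIED place with `|2|_w = 1`, ★ `measureReal_rankStratum_zero_of_ramified` gives
`μ(S₀) = (N𝔭_v)⁻¹ · μ(N ∩ K_v)` (the residue Heisenberg group of the ramified unitary group has `q` = `#𝓀` elements in the centre direction only: chart `N₀ ↔ 𝒪_E × 𝒪_F`,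
`N(𝔭) ↔ 𝔭_E × 𝒪_F`, paper §0).  At a ramified place `N𝔓_w = N𝔭_v` (★ `Rogawski1990.absNorm_placesOver_eq_of_ramified`), so either normalisation of `q` may be used downstream.
* **`measureReal_setOf_conj_mem_eq_ram`** — `μ.real {n : w₀ n w₀ ∈ I} = (N𝔭_v)⁻¹ · μ.real {n : n ∈ I}` (`he`, `h2w`).
HONEST LABEL: HC_CM is proved only modulo the 7 printed citations (2 remaining named inputs: hLiu418 = `stmt-HodgeConjecture-24832`, h413 = `stmt-HodgeConjecture-24833`) until rung 0
closes; count-neutral — one constant entry of the ramified d0B chain; the shell pieces (Z3-c-ram) and the type basis at `e = 2` remain.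

## References
* [Rogawski1990] J. D. Rogawski, *Automorphic Representations of Unitary Groups in Three Variables*, Ann. of Math. Stud. 123 (1990), §4.9 p. 54; §12.2 p. 173.
* [Casselman1980] W. Casselman, *The unramified principal series of p-adic groups I*, Compositio Math. 40 (1980), §3.
* [BruhatTits1972] F. Bruhat, J. Tits, *Groupes réductifs sur un corps local I*, Publ. Math. IHÉS 41 (1972), (4.4.4).
-/

set_option autoImplicit false
-- the mandated namespace has the single-problem summit's repeated segment (`HodgeConjecture.HodgeConjecture`)
set_option linter.dupNamespace false

noncomputable section

open NumberField IsDedekindDomain MeasureTheory Topology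
open scoped Matrix MatrixGroups WithZero ValuativeRel
open Literature.NumberTheory Literature.NumberTheory.Automorphic Literature.NumberTheory.Automorphic.UnitaryGroup
open Literature.NumberTheory.Rogawski1990 Literature.NumberTheory.Automorphic.IntegralReduction

namespace Summit.HodgeConjecture.HodgeConjecture.R90.S1

open Summit.HodgeConjecture.HodgeConjecture.Cruxes.H413 Summit.HodgeConjecture.HodgeConjecture.Cruxes.H413.K2E3BranchBHaarFactsN

/-! ## The frame (★ `K2E3BranchBHaarFactsN`, verbatim) -/

variable (L : Type) [Field L] [NumberField L] [IsCMField L] (v : HeightOneSpectrum (𝓞 ↥(maximalRealSubfield L)))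
  (w : PlacesOver L v) (hw : IsCMField.complexConj L • w.1 = w.1)
  (eA : Gqs L v ≃ₜ* ↥(unitaryGroupOfForm (galAdicCompletionMap (L := L) (IsCMField.complexConj L) hw) ((StdForm.antidiagonal 3).over (w.1.adicCompletion L))))
  (heA : ∀ g : Gqs L v,
    ((eA g : ↥(unitaryGroupOfForm (galAdicCompletionMap (L := L) (IsCMField.complexConj L) hw) ((StdForm.antidiagonal 3).over (w.1.adicCompletion L)))) :
        GL (Fin 3) (w.1.adicCompletion L)) =
      ((localNonsplitEquiv (IsCMField.complexConj L) (qsForm L) (IsCMField.complexConj_ne_one L) w hw g :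
        ↥(unitaryGroupOfForm (galAdicCompletionMap (L := L) (IsCMField.complexConj L) hw) (placeForm (qsForm L) w.1))) : GL (Fin 3) (w.1.adicCompletion L)))
  {ϖ : w.1.adicCompletion L} (hϖ : Valued.v ϖ = WithZero.exp (-1 : ℤ))
  (g₁ : GL (Fin 3) (w.1.adicCompletion L)) (hg₁ : (g₁ : Matrix (Fin 3) (Fin 3) (w.1.adicCompletion L)) = Matrix.diagonal ![(1 : w.1.adicCompletion L), 1, ϖ])
  (K0 K1 I : Subgroup (Gqs L v))
  (hK0 : K0 = ((glInt 3 (w.1.adicCompletion L)).subgroupOf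
    (unitaryGroupOfForm (galAdicCompletionMap (L := L) (IsCMField.complexConj L) hw) ((StdForm.antidiagonal 3).over (w.1.adicCompletion L)))).comap
      eA.toMulEquiv.toMonoidHom)
  (hK1 : K1 = (((glInt 3 (w.1.adicCompletion L)).map (MulAut.conj g₁).toMonoidHom).subgroupOf
    (unitaryGroupOfForm (galAdicCompletionMap (L := L) (IsCMField.complexConj L) hw) ((StdForm.antidiagonal 3).over (w.1.adicCompletion L)))).comap
      eA.toMulEquiv.toMonoidHom)
  (hI : I = K0 ⊓ K1)
  (t : ParabolicTriple (Gqs L v)) (ht : t = cmBorelTriple L 3 v)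
  (w₀ : Gqs L v) (hw₀ : Units.val (w₀.val : GL (Fin 3) (LocalRing L v)) = cmLocalForm L 3 v)

include hw heA hϖ hg₁ hK0 hK1 hI ht hw₀ in
/-- **`μ.real {n : w₀ n w₀ ∈ I} = q⁻¹ · μ.real {n : n ∈ I}`**, `q = N𝔭_v`, for EVERY Haar measure `μ` on `N(L⁺_v)`, at a non-split place `v` RAMIFIED in `L` with `|2|_w = 1`: ★ (place-generic)
`setOf_conj_mem_eq_rankStratum_zero` ∕ `setOf_coe_mem_eq_setOf_mem_integralLevel` turn both sets into the currency of ★ `measureReal_rankStratum_zero_of_ramified` (`μ_N(S₀) = q⁻¹ · μ_N(N ∩ K₃)`).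
This is `vol N(𝔭) ∕ vol N₀ = q⁻¹` of `PAPER-Z3-DepthZeroRamified` §0–§1, i.e. the ramified constant entry `Λ_{w₀}(f₁) = q⁻¹ · Λ_1(f_w)`. [cite: Rogawski1990, §4.9 p. 54; §12.2 p. 173] [cite: Casselman1980, §3] -/
theorem measureReal_setOf_conj_mem_eq_ram [instM : MeasurableSpace ↥t.N] [instB : BorelSpace ↥t.N] (μ : Measure ↥t.N) [instH : μ.IsHaarMeasure]
    (he : v.asIdeal.ramificationIdx' w.1.asIdeal ≠ 1) (h2w : Valued.v (2 : w.1.adicCompletion L) = 1) :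
    μ.real {m : ↥t.N | w₀ * (m : Gqs L v) * w₀ ∈ I} = (Ideal.absNorm v.asIdeal : ℝ)⁻¹ * μ.real {m : ↥t.N | (m : Gqs L v) ∈ I} := by
  rw [setOf_conj_mem_eq_rankStratum_zero L v w hw eA heA hϖ g₁ hg₁ K0 K1 I hK0 hK1 hI t ht w₀ hw₀,
    setOf_coe_mem_eq_setOf_mem_integralLevel L v w hw eA heA hϖ g₁ hg₁ K0 K1 I hK0 hK1 hI t ht]
  subst ht
  -- `subst` drops the local-instance registration of `instM ∕ instB ∕ instH`; hand them over explicitly (the carriers agree by `rfl`)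
  exact @measureReal_rankStratum_zero_of_ramified L _ _ _ v w hw instM instB μ instH he h2w

end Summit.HodgeConjecture.HodgeConjecture.R90.S1

end
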